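import Summits.ValiantsHypothesis.ValiantsHypothesis.Theorems.SymPencilPerFourPeeledTwoPencilCaseA
import Summits.ValiantsHypothesis.ValiantsHypothesis.Theorems.SymPencilPerFourPeeledTwoPencilReduction

/-!
# Route `SymPencil` — inner rank of the `2 | 2` row split of `per_4`: two-pencil FRAME DATA at the
# level of `4 × 4` matrices (`--supports` stmt-ValiantsHypothesis-5674 `SdcSuperquadratic`;
# (8,8) column, memo `NOTE-p8g15-5674-R2-two-pencil.md` §7; rung currency only)

`…TwoPencilReduction.false_of_peeled_of_frames` reduces HR2(11) (cell `(8,8,11)`) to the hypothesis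
`hframes : ∀ Ψ, ∃ (a₀ a₁ y₀ y₁ P₀₀ P₁₀ P₀₁ P₁₁ W₀ v s W), …` — frame data for every `4 × 4` matrix.
This file produces that `∃`-package from Hessian-pencil data (`frameData_of_hess`: `y_i = a₀ ∘ z_i`,
`W₀ = (Π a₀)⁻¹ D Ŵ₀ D`, `v_j = a₀ ∘ v̂_j`, `W = D⁻¹ Ŵ`, as in `…TwoPencilTransport`) and, as the
first matrix-level frame CLASS, from the Case-A data of `…TwoPencilCaseA` (`frameData_caseA`:
`a₀` with non-zero coordinates, `h, τ` in Case-A position, the incidences `a_j ⬝ Ψ (a₀∘z_i) = 0`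
and `Q ≠ 0` supplied by the caller — in the A₃ recipe `h = a₀ ∘ Ψᵀa₀` on the coordinates `0,1,2`
and `Ψᵀ a₁ ∈ K e₃` give the incidences for free, `incidence_caseA`).  So the top file of the
`(8,8,11)` case analysis can work with matrices only.

Honest framing: infrastructure; no cell closes here; the window of record, the crux
`SdcSuperquadratic` and `VP ≠ VNP` are untouched.  No definitions, no named facts. [folklore]
-/

noncomputable section

-- single-conjunct layout: Sub = Summit, duplicated namespace component intended
set_option linter.dupNamespace false

namespace Summit.ValiantsHypothesis.ValiantsHypothesis.Theorems.SymPencilPerFourPeeledTwoPencilFrameData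

open Matrix Finset Module
open Summit.ValiantsHypothesis.ValiantsHypothesis.Theorems.SymPencilPerFourPeeledTwoPencilTransport
open Summit.ValiantsHypothesis.ValiantsHypothesis.Theorems.SymPencilPerFourPeeledTwoPencilCaseA

universe u

variable {K : Type u} [Field K]

/-- **Frame data from Hessian-pencil data** (matrix level; cf. `…Transport.false_of_hess_frame`).
[folklore] -/
theorem frameData_of_hess (Ψ : Matrix (Fin 4) (Fin 4) K) (a₀ a₁ z₀ z₁ : Fin 4 → K)
    (ha : ∀ k, a₀ k ≠ 0)
    (hψ₀₀ : a₀ ⬝ᵥ Ψ *ᵥ (fun k => a₀ k * z₀ k) = 0) (hψ₀₁ : a₀ ⬝ᵥ Ψ *ᵥ (fun k => a₀ k * z₁ k) = 0)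
    (hψ₁₀ : a₁ ⬝ᵥ Ψ *ᵥ (fun k => a₀ k * z₀ k) = 0) (hψ₁₁ : a₁ ⬝ᵥ Ψ *ᵥ (fun k => a₀ k * z₁ k) = 0)
    (H₀ H₁ : Matrix (Fin 4) (Fin 4) K)
    (hH₀ : ∀ b l, H₀ b l = if b = l then 0 else (z₀ 0 + z₀ 1 + z₀ 2 + z₀ 3) - z₀ b - z₀ l)
    (hH₁ : ∀ b l, H₁ b l = if b = l then 0 else (z₁ 0 + z₁ 1 + z₁ 2 + z₁ 3) - z₁ b - z₁ l)
    (Wh₀ : Matrix (Fin 4) (Fin 4) K) (hWh₀ : Wh₀ * H₀ = 1)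
    (vh : Fin 4 → Fin 4 → K) (sh : Fin 4 → K) (hvh : ∀ j, H₁ *ᵥ vh j = sh j • H₀ *ᵥ vh j)
    (hsh : ∀ i j, i ≠ j → sh i ≠ sh j) (Wh : Matrix (Fin 4) (Fin 4) K)
    (hWh : Wh * Matrix.of vh = 1)
    (hQ : (Matrix.of fun b l : Fin 4 =>
          (Matrix.of ![a₁, Pi.single b (1 : K), (fun k => a₀ k * z₁ k), Pi.single l 1]).permanent) -
        (Matrix.of fun b l : Fin 4 =>
          (Matrix.of ![a₀, Pi.single b (1 : K), (fun k => a₀ k * z₁ k), Pi.single l 1]).permanent) *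
        ((a₀ 0 * a₀ 1 * a₀ 2 * a₀ 3)⁻¹ • (Matrix.diagonal a₀ * Wh₀ * Matrix.diagonal a₀)) *
        (Matrix.of fun b l : Fin 4 =>
          (Matrix.of ![a₁, Pi.single b (1 : K), (fun k => a₀ k * z₀ k), Pi.single l 1]).permanent)
        ≠ 0) :
    ∃ (a₀ a₁ y₀ y₁ : Fin 4 → K) (P₀₀ P₁₀ P₀₁ P₁₁ W₀ : Matrix (Fin 4) (Fin 4) K)
        (v : Fin 4 → Fin 4 → K) (s : Fin 4 → K) (W : Matrix (Fin 4) (Fin 4) K),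
        a₀ ⬝ᵥ Ψ *ᵥ y₀ = 0 ∧ a₀ ⬝ᵥ Ψ *ᵥ y₁ = 0 ∧ a₁ ⬝ᵥ Ψ *ᵥ y₀ = 0 ∧ a₁ ⬝ᵥ Ψ *ᵥ y₁ = 0 ∧
        (∀ b l, P₀₀ b l = (Matrix.of ![a₀, Pi.single b 1, y₀, Pi.single l 1]).permanent) ∧
        (∀ b l, P₁₀ b l = (Matrix.of ![a₀, Pi.single b 1, y₁, Pi.single l 1]).permanent) ∧
        (∀ b l, P₀₁ b l = (Matrix.of ![a₁, Pi.single b 1, y₀, Pi.single l 1]).permanent) ∧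
        (∀ b l, P₁₁ b l = (Matrix.of ![a₁, Pi.single b 1, y₁, Pi.single l 1]).permanent) ∧
        W₀ * P₀₀ = 1 ∧ (∀ j, P₁₀ *ᵥ v j = s j • P₀₀ *ᵥ v j) ∧ (∀ i j, i ≠ j → s i ≠ s j) ∧
        W * Matrix.of v = 1 ∧ P₁₁ - P₁₀ * W₀ * P₀₁ ≠ 0 := by
  let y₀ : Fin 4 → K := fun k => a₀ k * z₀ k
  let y₁ : Fin 4 → K := fun k => a₀ k * z₁ k
  let P₀₀ : Matrix (Fin 4) (Fin 4) K :=
    Matrix.of fun b l => (Matrix.of ![a₀, Pi.single b 1, y₀, Pi.single l 1]).permanent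
  let P₁₀ : Matrix (Fin 4) (Fin 4) K :=
    Matrix.of fun b l => (Matrix.of ![a₀, Pi.single b 1, y₁, Pi.single l 1]).permanent
  let P₀₁ : Matrix (Fin 4) (Fin 4) K :=
    Matrix.of fun b l => (Matrix.of ![a₁, Pi.single b 1, y₀, Pi.single l 1]).permanent
  let P₁₁ : Matrix (Fin 4) (Fin 4) K :=
    Matrix.of fun b l => (Matrix.of ![a₁, Pi.single b 1, y₁, Pi.single l 1]).permanent
  set pa : K := a₀ 0 * a₀ 1 * a₀ 2 * a₀ 3 with hpa
  have hpa0 : pa ≠ 0 := by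
    rw [hpa]; exact mul_ne_zero (mul_ne_zero (mul_ne_zero (ha 0) (ha 1)) (ha 2)) (ha 3)
  let D : Matrix (Fin 4) (Fin 4) K := Matrix.diagonal a₀
  let Di : Matrix (Fin 4) (Fin 4) K := Matrix.diagonal fun k => (a₀ k)⁻¹
  have hDDi : D * Di = 1 := by
    rw [Matrix.diagonal_mul_diagonal, ← Matrix.diagonal_one]
    congr 1; funext k; exact mul_inv_cancel₀ (ha k)
  have hDiD : Di * D = 1 := by
    rw [Matrix.diagonal_mul_diagonal, ← Matrix.diagonal_one]
    congr 1; funext k; exact inv_mul_cancel₀ (ha k)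
  have T0 : P₀₀ = pa • (Di * H₀ * Di) := transport_hess a₀ z₀ ha H₀ hH₀
  have T1 : P₁₀ = pa • (Di * H₁ * Di) := transport_hess a₀ z₁ ha H₁ hH₁
  let W₀ : Matrix (Fin 4) (Fin 4) K := pa⁻¹ • (D * Wh₀ * D)
  have hW₀ : W₀ * P₀₀ = 1 := by
    show (pa⁻¹ • (D * Wh₀ * D)) * P₀₀ = 1
    rw [T0, Matrix.smul_mul, Matrix.mul_smul, smul_smul, inv_mul_cancel₀ hpa0, one_smul]
    calc D * Wh₀ * D * (Di * H₀ * Di) = D * (Wh₀ * ((D * Di) * H₀)) * Di := by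
          simp only [Matrix.mul_assoc]
      _ = 1 := by rw [hDDi, Matrix.one_mul, hWh₀, Matrix.mul_one, hDDi]
  let v : Fin 4 → Fin 4 → K := fun j k => a₀ k * vh j k
  have hvD : ∀ j, v j = D *ᵥ vh j := fun j => by
    funext k; simp [v, D, Matrix.mulVec_diagonal]
  have hDD : ∀ M : Matrix (Fin 4) (Fin 4) K, Di * M * Di * D = Di * M := fun M => by
    rw [Matrix.mul_assoc, hDiD, Matrix.mul_one]
  have hv : ∀ j, P₁₀ *ᵥ v j = sh j • P₀₀ *ᵥ v j := by
    intro j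
    rw [T0, T1, hvD, Matrix.smul_mulVec, Matrix.smul_mulVec, Matrix.mulVec_mulVec,
      Matrix.mulVec_mulVec, hDD, hDD, ← Matrix.mulVec_mulVec, ← Matrix.mulVec_mulVec, hvh,
      Matrix.mulVec_smul, smul_smul, smul_smul, mul_comm]
  let W : Matrix (Fin 4) (Fin 4) K := Di * Wh
  have hW : W * Matrix.of v = 1 := by
    have hofv : Matrix.of v = Matrix.of vh * D := by
      ext i k; simp [v, D, Matrix.mul_diagonal, mul_comm]
    show Di * Wh * Matrix.of v = 1
    rw [hofv, Matrix.mul_assoc, ← Matrix.mul_assoc Wh, hWh, Matrix.one_mul, hDiD]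
  exact ⟨a₀, a₁, y₀, y₁, P₀₀, P₁₀, P₀₁, P₁₁, W₀, v, sh, W, hψ₀₀, hψ₀₁, hψ₁₀, hψ₁₁,
    fun b l => rfl, fun b l => rfl, fun b l => rfl, fun b l => rfl, hW₀, hv, hsh, hW, hQ⟩

/-- **Case-A incidences for free** (A₃ recipe): if `h_k = a₀_k (Ψᵀ a₀)_k` for `k = 0, 1, 2` and
`Ψᵀ a₁` is supported on the coordinate `3`, then `a_j ⬝ Ψ (a₀ ∘ z_i) = 0` for the Case-A points
`z₀ = (h₁ + τ h₂, -h₀, -τ h₀, 0)`, `z₁ = (h₂, 0, -h₀, 0)`. [folklore] -/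
theorem incidence_caseA (Ψ : Matrix (Fin 4) (Fin 4) K) (a₀ a₁ : Fin 4 → K) (h : Fin 4 → K) (τ : K)
    (hh : ∀ k : Fin 4, k ≠ 3 → h k = a₀ k * (Ψᵀ *ᵥ a₀) k)
    (ha₁ : ∀ k : Fin 4, k ≠ 3 → (Ψᵀ *ᵥ a₁) k = 0) :
    a₀ ⬝ᵥ Ψ *ᵥ (fun k => a₀ k * (![h 1 + τ * h 2, -h 0, -(τ * h 0), 0] : Fin 4 → K) k) = 0 ∧
    a₀ ⬝ᵥ Ψ *ᵥ (fun k => a₀ k * (![h 2, 0, -h 0, 0] : Fin 4 → K) k) = 0 ∧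
    a₁ ⬝ᵥ Ψ *ᵥ (fun k => a₀ k * (![h 1 + τ * h 2, -h 0, -(τ * h 0), 0] : Fin 4 → K) k) = 0 ∧
    a₁ ⬝ᵥ Ψ *ᵥ (fun k => a₀ k * (![h 2, 0, -h 0, 0] : Fin 4 → K) k) = 0 := by
  -- `a ⬝ Ψ y = (Ψᵀ a) ⬝ y`
  have hswap : ∀ (a y : Fin 4 → K), a ⬝ᵥ Ψ *ᵥ y = (Ψᵀ *ᵥ a) ⬝ᵥ y := by
    intro a y; rw [Matrix.dotProduct_mulVec, ← Matrix.mulVec_transpose]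
  have e0 := hh 0 (by decide); have e1 := hh 1 (by decide); have e2 := hh 2 (by decide)
  have f0 := ha₁ 0 (by decide); have f1 := ha₁ 1 (by decide); have f2 := ha₁ 2 (by decide)
  refine ⟨?_, ?_, ?_, ?_⟩
  · rw [hswap]; simp [dotProduct, Fin.sum_univ_four]
    linear_combination (-(h 1 + τ * h 2)) * e0 + h 0 * e1 + τ * h 0 * e2
  · rw [hswap]; simp [dotProduct, Fin.sum_univ_four]
    linear_combination (-(h 2)) * e0 + h 0 * e2
  · rw [hswap]; simp [dotProduct, Fin.sum_univ_four, f0, f1, f2]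
  · rw [hswap]; simp [dotProduct, Fin.sum_univ_four, f0, f1, f2]

end Summit.ValiantsHypothesis.ValiantsHypothesis.Theorems.SymPencilPerFourPeeledTwoPencilFrameData

end
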